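import Summits.CriticalPhenomena.PercolationContinuityZ3.Theorems.PercNearOneGluingNoHeavyLowerTailKnQuestion8TwoRelays
import HarnessLib

/-!
# (41) for a relay dominated by the observer off `{0 ↔ A}` — a by-product of the Question-8 transfer lemma

Helper for crux `PercNearOneGluingNoHeavy.NoHeavyLowerTail` (item stmt-CriticalPhenomena-4575, closed), lemma factory
prim-lf-2 (deletion–contraction), gen 14.  No definitions, no named facts, no sorries; standard axioms.

For EVERY relay set `A`, every `c ∈ A`, `c ≠ 0`: if `μ(0 ↮ A) > 0` and `μ({c↔b} ∖ {0↔A}) ≤ μ({0↔b} ∖ {0↔A})` — the relay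
is at most as `b`-reliable as the observer itself OFF the event `{0 ↔ A}` — then Kozma–Nitzan's pre-FKG inequality (41)
holds at `0` for `c`:  `μ({c↔b} ∩ {0↔A}) ≤ μ({0↔b} ∩ {0↔A})` (`KnQ8.block41_of_le_observer_off`).  Proof:
`KnQ8.transfer_across` with `t = c`, `s = 0`, `X = {0}`, `Q = {0 ↔ A.erase c}` (an increasing event of `C_0`), `B = {c↔b}`,
`A' = {0↔b}`; the comparison off `Q` is the hypothesis, the comparison on `Q` is the restricted (41).  Compare the tree's
`blockQ9_of_reliableBlock` at `O = {0}` (prim-lf-1), where the UNCONDITIONAL domination `μ(c↔b) ≤ μ(0↔b)` is assumed instead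
(Kozma–Nitzan Lemma 3(i)); neither hypothesis implies the other.
[cite: KozmaNitzan2024, display (41) and §5.5 (p. 36); Lemma 3 (pp. 6–7)] [cite: VandenbergHaggstromKahn2005, Thms. 1.4–1.5 (pp. 7–8)]
-/

noncomputable section

namespace Summit.CriticalPhenomena.PercolationContinuityZ3.Theorems

open MeasureTheory Set
open Literature.Probability.LatticeModels (prodBernoulli)
open Literature.Probability.Percolation
open scoped Classical

namespace KnQ8

variable {V : Type*} [Fintype V]

/-- **(41) for a relay that is at most as reliable as the observer OFF `{o ↔ A}`.**  For every relay set `A`, every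
`c ∈ A` with `c ≠ o`: if `μ(o ↮ A) > 0` and `μ({c↔b} ∖ {o↔A}) ≤ μ({o↔b} ∖ {o↔A})`, then
`μ({c↔b} ∩ {o↔A}) ≤ μ({o↔b} ∩ {o↔A})`.  (`transfer_across` with `t = c`, `s = o`, `X = {o}`, `Q = {o ↔ A.erase c}`;
compare `blockQ9_of_reliableBlock` at `O = {o}`, where the unconditional `μ(c↔b) ≤ μ(o↔b)` is assumed instead.)
[cite: KozmaNitzan2024, display (41) and §5.5 (p. 36)] [cite: VandenbergHaggstromKahn2005, Thms. 1.4–1.5 (pp. 7–8)] -/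
theorem block41_of_le_observer_off (w : Sym2 V → unitInterval) (A : Finset V) (o b c : V) (hcA : c ∈ A)
    (hco : c ≠ o)
    (hpos : 0 < (prodBernoulli w).real (SoloBlindKN.connTo o A)ᶜ)
    (hle : (prodBernoulli w).real (openConn c b \ SoloBlindKN.connTo o A) ≤
      (prodBernoulli w).real (openConn o b \ SoloBlindKN.connTo o A)) :
    (prodBernoulli w).real (openConn c b ∩ SoloBlindKN.connTo o A) ≤
      (prodBernoulli w).real (openConn o b ∩ SoloBlindKN.connTo o A) := by
  set μ := prodBernoulli w with hμ
  set X : Set V := {o} with hX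
  set N : Set (BondConfig V) := {ω | ∀ x ∈ X, ¬ (openGraph ω).Reachable c x} with hN
  set Q : Set (BondConfig V) := SoloBlindKN.connTo o (A.erase c) with hQ
  set U : Set (BondConfig V) := SoloBlindKN.connTo o A with hU
  have hNiff : ∀ ω : BondConfig V, ω ∈ N ↔ ¬ (openGraph ω).Reachable c o := by
    intro ω; simp only [hN, hX, mem_setOf_eq, mem_singleton_iff, forall_eq]
  have hQiff : ∀ ω : BondConfig V, ω ∈ Q ↔ ∃ y ∈ A, y ≠ c ∧ (openGraph ω).Reachable o y := by
    intro ω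
    simp only [hQ, SoloBlindKN.connTo, mem_iUnion, exists_prop, Finset.mem_erase, openConn, mem_setOf_eq]
    constructor
    · rintro ⟨y, ⟨hyc, hyA⟩, hy⟩; exact ⟨y, hyA, hyc, hy⟩
    · rintro ⟨y, hyA, hyc, hy⟩; exact ⟨y, ⟨hyc, hyA⟩, hy⟩
  have hUiff : ∀ ω : BondConfig V, ω ∈ U ↔ ∃ y ∈ A, (openGraph ω).Reachable o y := by
    intro ω
    simp only [hU, SoloBlindKN.connTo, mem_iUnion, exists_prop, openConn, mem_setOf_eq]
  -- `N ∩ Qᶜ = Uᶜ`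
  have eNQ : N ∩ Qᶜ = Uᶜ := by
    ext ω
    simp only [mem_inter_iff, mem_compl_iff, hNiff, hQiff, hUiff, not_exists, not_and]
    constructor
    · rintro ⟨hnco, hq⟩ y hyA hoy
      by_cases hyc : y = c
      · exact hnco (hyc ▸ hoy).symm
      · exact hq y hyA hyc hoy
    · intro hu
      exact ⟨fun hco' => hu c hcA hco'.symm, fun y hyA _ hoy => hu y hyA hoy⟩
  -- off `{o ↔ c}`, `U` is `Q`
  have eUQ : ∀ E : Set (BondConfig V), E ∩ U ∩ (openConn o c)ᶜ = N ∩ Q ∩ E := by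
    intro E
    ext ω
    simp only [mem_inter_iff, mem_compl_iff, hNiff, hQiff, hUiff, openConn, mem_setOf_eq]
    constructor
    · rintro ⟨⟨hE, y, hyA, hoy⟩, hnoc⟩
      refine ⟨⟨fun h => hnoc h.symm, y, hyA, ?_, hoy⟩, hE⟩
      rintro rfl; exact hnoc hoy
    · rintro ⟨⟨hnco, y, hyA, _, hoy⟩, hE⟩
      exact ⟨⟨hE, y, hyA, hoy⟩, fun h => hnco h.symm⟩
  have hm : MeasurableSet (openConn o c : Set (BondConfig V)) := MeasurableSet.of_discrete
  have hsplit : ∀ E : Set (BondConfig V),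
      μ.real (E ∩ U) = μ.real (E ∩ U ∩ openConn o c) + μ.real (E ∩ U ∩ (openConn o c)ᶜ) := by
    intro E
    rw [← measureReal_inter_add_sdiff (s := E ∩ U) hm, Set.sdiff_eq]
  have e1 : (openConn c b : Set (BondConfig V)) ∩ U ∩ openConn o c = openConn o b ∩ U ∩ openConn o c := by
    ext ω
    simp only [mem_inter_iff, openConn, mem_setOf_eq]
    constructor
    · rintro ⟨⟨hcb, hu⟩, hoc⟩; exact ⟨⟨hoc.trans hcb, hu⟩, hoc⟩
    · rintro ⟨⟨hob, hu⟩, hoc⟩; exact ⟨⟨hoc.symm.trans hob, hu⟩, hoc⟩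
  have hoX : o ∈ X := by simp [hX]
  have hcX : c ∉ X := by simpa [hX] using hco
  have hle' : μ.real (N ∩ Qᶜ ∩ openConn c b) ≤ μ.real (N ∩ Qᶜ ∩ openConn o b) := by
    rw [eNQ, inter_comm Uᶜ, inter_comm Uᶜ, ← Set.sdiff_eq, ← Set.sdiff_eq]
    exact hle
  have hpos' : 0 < μ.real (N ∩ Qᶜ) := by rw [eNQ]; exact hpos
  have key := transfer_across_of_pos w c o X hoX hcX (openConn c b) (openConn o b) Q
    (openConn_mono_openEdgeCluster c b) (openConn_mono_openEdgeCluster o b)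
    (connTo_mono_openEdgeCluster o (A.erase c)) hpos' hle'
  rw [hsplit (openConn c b), hsplit (openConn o b), e1, eUQ, eUQ]
  exact add_le_add le_rfl key

end KnQ8

end Summit.CriticalPhenomena.PercolationContinuityZ3.Theorems

end
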